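import Summits.QuantumFields.BalabanUV.Beta.FP.TadpoleAdInvarianceColour
import Literature.MathematicalPhysics.QuantumFieldTheory.Balaban1983to89.Beta.GhostTable

/-!
# `BalabanUV.Beta.FP.TadpoleAdInvarianceColourSU2` — road «FP» for binder row D1, organisation γ, sub-row **GAMMA-0c (S4-AD), item (i)**, companion of
# `FP/TadpoleAdInvarianceColour`: THE `ε_{abc}` SPELLING OF THE su(2) INSTANCE («instance SU(2) = `ε_{abc}`», owner l.24514 (E)) over lit1's explicit
# `GhostTable.adPauli b = of (d c ↦ −2·ε_{bcd})` (`adPauli_eq_adMat` ✓): `(∀ b, adPauli b *ᵥ x = 0) → x = 0` and `(∀ b d, Σ_c ε_{bcd}·x_c = 0) → x = 0`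

HONEST DEPENDENCY (page 1, mandatory): continuum YM on T⁴ ⇐ BetaPertH ∧ nine spine estimates (0/9 proved); BetaPertH ⇐ (D1) ∧ (D4) ∧ CAP+tail;
G-an2-4 gates asym, D1 and NE2/3/4.  HONEST FRAMING (cell contract, verbatim): «discharging `BetaPertH` makes Bałaban's UV stability UNCONDITIONAL —
a real constructive-QFT result; it is NOT the continuum limit and NOT the Clay problem.»  THIS MODULE DISCHARGES NOTHING of the wall: [folklore]
three-line corollaries of `TadpoleAdInvarianceColour.coord_eq_zero_of_adMat_pauli_mulVec_eq_zero` and lit1's `GhostTable.adPauli_eq_adMat` BY NAME (split off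
only because `GhostTable`'s import cone is heavy).  No `def`, no `def … : Prop`, nothing cited, 0 sorry; 0 estimates; 0∕4 row-D1 binders; NOT D1, NOT BetaPertH,
NOT continuum, NOT Clay.

ABSOLUTE RULE (cell charter, verbatim): «No internally-minted statement may enter as a cited fact. Every hypothesis is either kernel-proved in this
package or a verbatim quotation of a PUBLISHED theorem with page reference. The manuscript(s) under audit are NOT citable for their own disputed steps —
they are the thing under adjudication; programme-internal (2001/route/tribunal) claims are never citable.»
Provenance: cross-cell idle seat b2b-balaban-t4-ne7b-formalise-leaf-09 (gen 20, prover-b2b-balaban-t4-ne7b-formalise-leaf-09-g20-0) for road FP owner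
b2b-balaban-beta-d1-p3, 2026-08-21 (sub-row GAMMA-0c item (i); journal INTENT «GAMMA-0c (i)» l.24668).  [folklore], 0 def, 0 cite, 0 sorry.
-/

noncomputable section

namespace Summit.QuantumFields.BalabanUV.Beta.FP.TadpoleAdInvarianceColourSU2

open Matrix Finset
open scoped BigOperators Matrix
open Literature.MathematicalPhysics.QuantumFieldTheory.Balaban1983to89.Beta.GhostTable (lc adPauli adPauli_eq_adMat)
open Summit.QuantumFields.BalabanUV.Beta.FP.TadpoleAdInvarianceColour (coord_eq_zero_of_adMat_pauli_mulVec_eq_zero)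

/-- [folklore] **`su(2)` = `ε_{abc}`**: with lit1's explicit `GhostTable.adPauli b = of (d c ↦ −2·ε_{bcd})` (`adPauli_eq_adMat` ✓),
`(∀ b, adPauli b *ᵥ x = 0) → x = 0`. -/
theorem coord_eq_zero_of_adPauli_mulVec_eq_zero {x : Fin 3 → ℝ} (h : ∀ b, adPauli b *ᵥ x = 0) : x = 0 :=
  coord_eq_zero_of_adMat_pauli_mulVec_eq_zero fun b => by rw [← adPauli_eq_adMat]; exact h b

/-- [folklore] **THE LEVI-CIVITA FORM** (the owner's «instance SU(2) = `ε_{abc}`», decide-free): `(∀ b d, Σ_c ε_{bcd}·x_c = 0) → x = 0`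
(`ε = GhostTable.lc`). -/
theorem coord_eq_zero_of_leviCivita {x : Fin 3 → ℝ} (h : ∀ b d, ∑ c, lc b c d * x c = 0) : x = 0 := by
  refine coord_eq_zero_of_adPauli_mulVec_eq_zero fun b => ?_
  funext d
  simp only [Matrix.mulVec, dotProduct, adPauli, Matrix.of_apply, Pi.zero_apply]
  rw [Finset.sum_congr rfl fun c _ => by rw [mul_assoc], ← Finset.mul_sum, h b d, mul_zero]


end Summit.QuantumFields.BalabanUV.Beta.FP.TadpoleAdInvarianceColourSU2

end
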